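import Literature.MathematicalPhysics.QuantumFieldTheory.Balaban1983to89.B6SectAOperatorsV1
import Literature.MathematicalPhysics.QuantumFieldTheory.Balaban1983to89.B15DeterminingSets

/-!
# NODE 00 — the BRIDGE from a V1 nested family's constraints to the record's determining-set fibre `genSet`: if the family's DEEP blocks sit one bond-layer inside
# the regions `Ω_{j+1}`, then every bond of `𝐁 = ⋃Γ_j` ([III] (2.2), bonds «which intersect» Γ_j) has end-points NOT deep for the family, so (Lemma V) its straight
# averages are determined by the family's constraints — `ker Q_{V1}(D) ⊆ T_𝐁`; with the located EXCEPTION made explicit: the inward crossing bonds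

Cell `pub-ymgap` (HUMAN RULINGS D-0062 ∕ D-0088), seat `pub-ymgap-dag-n07-e` g20 (R141 (C) row s3 lineage; DAG node N07 = [B11]; lane owner), 2026-08-28.  `--kind proof --supports
stmt-QuantumFields-20541` (K0⁷; count-neutral).  File D of INTENT-44 (theorems only); companion of `Node00/DomainsRefinement` (p613194) and `Node00/DomainsMeet`.
Types the located seam LOCATED-INNER-INTERFACE-BONDS (cell bus 2026-08-28 07:41Z) as a theorem with its hypothesis displayed.

THE PRINT, TWO CONVENTIONS.  [B6] = T. Bałaban, *Propagators and renormalization transformations for lattice gauge theories. II*, CMP **96** (1984) `[Balaban1984PropagatorsII]`,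
p. 224: *«If Ω ⊂ T_η, then we denote by Ω also the set of bonds ⋃_{x∈Ω} st(x) = {bonds b ⊂ T_η: at least one end-point of b belongs to Ω}. Let us define Λ_j = Ω_j^{(j)} ∖ Ω_{j+1}^{(j)}
(2.3) for the sets of sites and the sets of bonds; thus we have Ω_1 = ⋃_{j=1}^k B^j(Λ_j), T = ⋃_{j=0}^k B^j(Λ_j) (2.4)»* — the tree's V1 reading (`B6SectADomainsV1.Domains.LamBond j b :=
(b₋ ∈ Ω_j ∨ b₊ ∈ Ω_j) ∧ ¬Deep b₋ ∧ ¬Deep b₊`): a level-`j` bond with an end-point inside `Ω_{j+1}` is NOT indexed at level `j` (it lies in the level-(j+1) tube `B^{j+1}(Λ_{j+1})`;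
(2.4) is a partition).  [III] = *Convergent renormalization expansions for lattice gauge theories*, CMP **119** (1988) `[Balaban1988Convergent]` p. 255 (2.2): *«Γ₀ = Ω₁ᶜ, Γ_j =
Ω_j^{(j)} ∖ Ω_{j+1}^{(j)}, j = 1, …, k − 1, Γ_k = Ω_k^{(k)}, 𝐁 = ⋃Γ_j. This definition is meant for sets of points, bonds and plaquettes, with the convention described in Sect. 0 [I]»*,
and [I] = CMP **109** (1987) `[Balaban1987RG1]` p. 251: *«a set of bonds, i.e. intervals b connecting nearest neighbor points b₋, b₊, which INTERSECT it»* — the tree's B15 reading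
(`B15DeterminingSets.bondsOf S := {b | b₋ ∈ S ∨ b₊ ∈ S}` applied to `genSet Ω k j = (Γ_j)^{(j)}`): a level-`j` bond from `Γ_j` INTO `Ω_{j+1}^{(j)}` («inward crossing») IS a bond of
`𝐁` at level `j`.  The record's fibre (`Setup.IsBackground … (genSet s.Ω k)`, `B15DeterminingSets.AgreeOn`) uses [III]∕[I]; the flat heart (UST `FlatCubeOperators`, k0-s1's S4a files) uses
V1's `BondIdx D`.  For the SAME region sequence the two index sets differ exactly by the inward crossing bonds, so `T_𝐁 ⊊ ker Q_{V1}` at every inner interface `∂Ω_{j+1}`.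

WHAT THIS FILE PROVES (sorry-free; no definition; axioms standard; generic `P : Params`; ANY V1 family `D`, ANY region sequence `Ω : ℕ → Set (Site P 0)`, ANY top level `k`).
* §1 `gammaRegion_disjoint_succ` (`x ∈ Γ_j ⇒ x ∉ Ω_{j+1}` for `j < k`), `exists_mem_gammaRegion_of_mem_bondsOf_genSet` (a bond of `𝐁` at level `j` has an end-point centred in `Γ_j`).
* §2 ★★★ `not_deep_of_mem_bondsOf_genSet` — under the displayed LAYER CONDITION `hlayer : ∀ j < k, ∀ b : PBond P j, (D.Deep j b₋ ∨ D.Deep j b₊) → embIter j b₋ ∈ Ω (j+1) ∧ embIter j b₊ ∈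
  Ω (j+1)` («a level-j bond touching a DEEP block of the family has BOTH end-points centred inside Ω_{j+1}», i.e. the family's deep blocks sit one bond-layer inside the record's regions)
  and `hk : D.k ≤ k`, every bond of `bondsOf (genSet Ω k j)` has BOTH end-points not `D`-deep at level `j`, for every `j`.
* §3 ★★★ `bondAvgIter_eq_zero_of_mem_bondsOf_genSet` — hence (lit-balaban's Lemma V `bondAvgIter_eq_zero_of_constr_zero`) if the straight averages of `A` vanish on every `D`-indexed
  bond, they vanish on every bond of `𝐁`: `ker Q_{V1}(D) ⊆ T_𝐁` in the straight-average letters; operator form ★ `bondAvgIter_eq_zero_of_QE_eq_zero_of_mem_bondsOf_genSet` (`QE D x = 0 ⇒ …`).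
* §4 the converse direction, unconditional: `lamBond_subset_bondsOf` — for the family READ OFF a sequence by centres (`y ∈ Ω_j^{(j)} :⇔ embIter j y ∈ Ω j`), every V1-indexed bond IS a
  bond of `𝐁` at the same level (exclusive ⊆ inclusive); stated in hypothesis form on `D` (`hOm : ∀ j, 1 ≤ j → j ≤ k → ∀ y, y ∈ D.Om j ↔ embIter j y ∈ Ω j`, `hk : D.k = k`,
  `hsat` = level saturation of the `Ω_j`) so that it applies to `Node00/DomainsOfSeq` (file C) by `exact`.
WHERE `hlayer` HOLDS ∕ FAILS (docstring facts, not theorems here): it holds for `Node00.cubeDomains` at an INTERIOR datum (deep at level `j` ⇒ inside `□_{j+1} ⊂ Ω_{j+1}` with the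
(144) collar) and for any family whose regions are the record's SHRUNK by one big-block layer (`cubeDomains ⊓ shrink(domainsOfSeq s)`); it FAILS for the plain meet
`cubeDomains ⊓ domainsOfSeq s` at a BOUNDARY datum (a deep block of `□_k ∩ Ω_k` adjacent to `□_k ∖ Ω_k`) — the located seam; nothing about those families is asserted in this file.
HONEST SCOPE.  Set bookkeeping over `B15DeterminingSets` (`genSet`, `gammaRegion_*`, `bondsOf`) and V1 (`Deep`, `LamBond`, Lemma V, `QE_eq_zero_iff`) BY NAME; the letters are V1's
STRAIGHT averages (the record's linearised (0.4) average differs by the comb pure gauge — k0-s1-w1's `…K0Stub1FlatAveragingDictionary`); which convention is print's for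
[Balaban1985Variational] (6) is a lit-desk question (cell bus), not decided here; nothing of the analysis asserted; `stub_prop8StepCoP13` ∕ K0⁷ NOT closed; N07 NOT discharged; counts
unmoved (28∕28 · 5∕27); one finite 𝕋⁴ programme at fixed ε — the route closes the conditional finite-𝕋⁴ rung `BalabanLadder.UV` only; nothing continuum ∕ ℝ⁴ ∕ OS ∕ mass gap ∕ Clay.
No `sorry`, no `def`, no `instance`, no `notation`.

References: [B6] (2.1)–(2.4), (2.6) p. 224, (2.20) p. 226; [III] (2.2) p. 255, (2.10)–(2.11) p. 256; [I] Sect. 0 p. 251; [Balaban1985Variational] (3)–(6) p. 278, (150) p. 301.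
-/

set_option autoImplicit false

namespace Literature.MathematicalPhysics.QuantumFieldTheory.Balaban1983to89.Node00

open LatticeFieldCalculus (bondAvgIter)
open B6SectADomainsV1 (Domains)
open B6SectAOperatorsV1 (QE QE_eq_zero_iff)
open B15DeterminingSets (embIter pts genSet gammaRegion bondsOf gammaRegion_of_gt gammaRegion_self gammaRegion_zero gammaRegion_mid)
open BalabanImbrieJaffe1984to88.BIJ85AxialPropagator411 (BondSpace)

variable {P : Params}

/-! ## §1  The regions `Γ_j` avoid `Ω_{j+1}` below the top; bonds of `𝐁` have an end-point centred in `Γ_j` -/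

/-- Below the top level a point of `Γ_j` is not in `Ω_{j+1}` (`Γ₀ = Ω₁ᶜ`, `Γ_j = Ω_j ∖ Ω_{j+1}` for `1 ≤ j < k`). [cite: Balaban1988Convergent, (2.2) p.255] -/
theorem not_mem_succ_of_mem_gammaRegion (Ω : ℕ → Set (Site P 0)) {k j : ℕ} (hjk : j < k) {x : Site P 0} (hx : x ∈ gammaRegion Ω k j) : x ∉ Ω (j + 1) := by
  rcases Nat.eq_zero_or_pos j with rfl | hj0
  · rw [gammaRegion_zero Ω hjk] at hx
    exact hx
  · rw [gammaRegion_mid Ω hj0 hjk] at hx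
    exact hx.2

/-- A bond of `𝐁` at level `j` ([I] Sect. 0: bonds «which intersect» `Γ_j`) has an end-point whose centre lies in `Γ_j`. [cite: Balaban1987RG1, (0.1) p.251; Balaban1988Convergent, (2.2) p.255] -/
theorem exists_endpoint_mem_gammaRegion_of_mem_bondsOf_genSet (Ω : ℕ → Set (Site P 0)) {k j : ℕ} {b : PBond P j} (hb : b ∈ bondsOf (genSet Ω k j)) :
    embIter j b.src ∈ gammaRegion Ω k j ∨ embIter j b.tgt ∈ gammaRegion Ω k j := hb

/-- Above the top level `𝐁` has no bonds (the same one-liner is the Summits-side `…N11BackgroundScaleLocal.not_mem_bondsOf_genSet_of_lt`, not importable into `Literature`; restated).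
[cite: Balaban1988Convergent, (2.2) p.255] -/
theorem not_mem_bondsOf_genSet_of_gt (Ω : ℕ → Set (Site P 0)) {k j : ℕ} (hkj : k < j) (b : PBond P j) : b ∉ bondsOf (genSet Ω k j) := by
  rintro (h | h) <;> simp [genSet, gammaRegion_of_gt Ω hkj] at h

/-! ## §2  Under the layer condition every bond of `𝐁` has non-deep end-points -/

/-- ★★★ **Bonds of the determining set have non-deep end-points** for every V1 family whose deep blocks sit one bond-layer inside the regions: if every level-`j` bond touching a `D`-deep
block has both end-points centred in `Ω_{j+1}` (`j < k`) and `D` has at most `k` levels, then for every `j` and every `b ∈ bondsOf (genSet Ω k j)` neither end-point of `b` is `D`-deep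
at level `j`.  (The inward crossing bonds `⟨y ∈ Γ_j, y′ ∈ Ω_{j+1}^{(j)}⟩` of [I]'s convention are where the hypothesis works: `y′`'s block, if deep, would put `y` inside `Ω_{j+1}`.)
[cite: Balaban1984PropagatorsII, (2.3) p.224; Balaban1988Convergent, (2.2) p.255; Balaban1985Variational, (150) p.301] -/
theorem not_deep_of_mem_bondsOf_genSet (D : Domains P) (Ω : ℕ → Set (Site P 0)) (k : ℕ) (hk : D.k ≤ k)
    (hlayer : ∀ j : ℕ, j < k → ∀ b : PBond P j, (D.Deep j b.src ∨ D.Deep j b.tgt) → embIter j b.src ∈ Ω (j + 1) ∧ embIter j b.tgt ∈ Ω (j + 1))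
    {j : ℕ} {b : PBond P j} (hb : b ∈ bondsOf (genSet Ω k j)) : ¬ D.Deep j b.src ∧ ¬ D.Deep j b.tgt := by
  rcases lt_trichotomy j k with hjk | rfl | hkj
  · -- below the top: an end-point is centred in Γ_j, which avoids Ω_{j+1}; a deep end-point would force both centres into Ω_{j+1}
    have key : ¬ (D.Deep j b.src ∨ D.Deep j b.tgt) := by
      intro hdeep
      obtain ⟨hs, ht⟩ := hlayer j hjk b hdeep
      rcases exists_endpoint_mem_gammaRegion_of_mem_bondsOf_genSet Ω hb with h | h
      · exact not_mem_succ_of_mem_gammaRegion Ω hjk h hs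
      · exact not_mem_succ_of_mem_gammaRegion Ω hjk h ht
    exact ⟨fun h => key (Or.inl h), fun h => key (Or.inr h)⟩
  · -- at the top nothing is deep
    exact ⟨D.not_deep_of_le hk _, D.not_deep_of_le hk _⟩
  · exact absurd hb (not_mem_bondsOf_genSet_of_gt Ω hkj b)

/-! ## §3  Hence the family's constraints determine the averages on `𝐁`: `ker Q_{V1}(D) ⊆ T_𝐁` -/

/-- ★★★ **`ker Q_{V1}(D) ⊆ T_𝐁`** (straight-average letters): under the layer condition, if the straight `i`-fold averages of `A` vanish on every `D`-indexed bond (V1's (2.6) with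
`B = 0`), then the `j`-fold average of `A` vanishes on every bond of the determining set `𝐁 = ⋃Γ_j` of the sequence `Ω` — Lemma V (`bondAvgIter_eq_zero_of_constr_zero`) at the
non-deep end-points of §2.  This is the inclusion a criticality transfer FROM the record's fibre `AgreeOn (genSet Ω k)` TO the tangent space `ker Q_V(D)` of a per-cube family needs.
[cite: Balaban1984PropagatorsII, (2.6) p.224, (2.20) p.226; Balaban1988Convergent, (2.10)–(2.11) p.256; Balaban1985Variational, (150) p.301] -/
theorem bondAvgIter_eq_zero_of_mem_bondsOf_genSet (D : Domains P) (Ω : ℕ → Set (Site P 0)) (k : ℕ) (hk : D.k ≤ k)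
    (hlayer : ∀ j : ℕ, j < k → ∀ b : PBond P j, (D.Deep j b.src ∨ D.Deep j b.tgt) → embIter j b.src ∈ Ω (j + 1) ∧ embIter j b.tgt ∈ Ω (j + 1))
    {A : VecField P 0 ℝ} (hA : ∀ (i : ℕ) (b : PBond P i), D.LamBond i b → bondAvgIter i A b = 0)
    {j : ℕ} {b : PBond P j} (hb : b ∈ bondsOf (genSet Ω k j)) : bondAvgIter j A b = 0 := by
  obtain ⟨hs, ht⟩ := not_deep_of_mem_bondsOf_genSet D Ω k hk hlayer hb
  exact D.bondAvgIter_eq_zero_of_constr_zero hA j b hs ht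

/-- ★ Operator form: `QE D x = 0` (lit-balaban's multi-scale `Q` of (2.20)) ⇒ the `j`-fold straight average of `x` vanishes on every bond of `𝐁`.
[cite: Balaban1984PropagatorsII, (2.20) p.226; Balaban1988Convergent, (2.2) p.255] -/
theorem bondAvgIter_eq_zero_of_QE_eq_zero_of_mem_bondsOf_genSet (D : Domains P) (Ω : ℕ → Set (Site P 0)) (k : ℕ) (hk : D.k ≤ k)
    (hlayer : ∀ j : ℕ, j < k → ∀ b : PBond P j, (D.Deep j b.src ∨ D.Deep j b.tgt) → embIter j b.src ∈ Ω (j + 1) ∧ embIter j b.tgt ∈ Ω (j + 1))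
    {x : BondSpace P} (hx : QE D x = 0) {j : ℕ} {b : PBond P j} (hb : b ∈ bondsOf (genSet Ω k j)) : bondAvgIter j (WithLp.ofLp x) b = 0 :=
  bondAvgIter_eq_zero_of_mem_bondsOf_genSet D Ω k hk hlayer ((QE_eq_zero_iff D x).mp hx) hb

/-- The layer condition is MONOTONE: if it holds for `D` it holds for every family below `D` (`Om′ ⊆ Om` levelwise — file A's refinement order), since `D′`-deep implies `D`-deep.
[cite: Balaban1985Variational, (150) p.301 (bookkeeping)] -/
theorem layer_of_domainsLe {D' D : Domains P} (h : ∀ j : ℕ, D'.Om j ⊆ D.Om j) (Ω : ℕ → Set (Site P 0)) (k : ℕ)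
    (hlayer : ∀ j : ℕ, j < k → ∀ b : PBond P j, (D.Deep j b.src ∨ D.Deep j b.tgt) → embIter j b.src ∈ Ω (j + 1) ∧ embIter j b.tgt ∈ Ω (j + 1)) :
    ∀ j : ℕ, j < k → ∀ b : PBond P j, (D'.Deep j b.src ∨ D'.Deep j b.tgt) → embIter j b.src ∈ Ω (j + 1) ∧ embIter j b.tgt ∈ Ω (j + 1) :=
  fun j hj b hdeep => hlayer j hj b (hdeep.imp (fun hs => h (j + 1) hs) (fun ht => h (j + 1) ht))

/-! ## §4  The converse inclusion is unconditional: V1-indexed bonds of the family read off `Ω` by centres are bonds of `𝐁` -/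

/-- For a family READ OFF the sequence by centres (`y ∈ Ω_j^{(j)} :⇔ embIter j y ∈ Ω j` for `1 ≤ j ≤ k`, `k` levels) over LEVEL-SATURATED regions (`Ω_{j+1}` a union of
`(j+1)`-blocks, read through the centres of `j`-blocks: `embIter (j+1) (blockOf y) ∈ Ω (j+1) ↔ embIter j y ∈ Ω (j+1)`), every V1-indexed bond at level `j` is a bond of `𝐁` at
level `j`: `{Λ_j-bonds of [B6] (2.3)} ⊆ {bonds of [I] Sect. 0 intersecting Γ_j}` — the EXCLUSIVE index set is contained in the INCLUSIVE one (the difference = the inward crossing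
bonds, see the header). [cite: Balaban1984PropagatorsII, (2.3) p.224; Balaban1987RG1, (0.1) p.251; Balaban1988Convergent, (2.2) p.255] -/
theorem mem_bondsOf_genSet_of_lamBond (D : Domains P) (Ω : ℕ → Set (Site P 0)) (hk1 : 1 ≤ D.k)
    (hOm : ∀ j : ℕ, 1 ≤ j → j ≤ D.k → ∀ y : Site P j, y ∈ D.Om j ↔ embIter j y ∈ Ω j)
    (hsat : ∀ j : ℕ, j < D.k → ∀ y : Site P j, embIter (j + 1) (blockOf y) ∈ Ω (j + 1) ↔ embIter j y ∈ Ω (j + 1))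
    {j : ℕ} {b : PBond P j} (hb : D.LamBond j b) : b ∈ bondsOf (genSet Ω D.k j) := by
  obtain ⟨hmem, hs, ht⟩ := hb
  have hjk : j ≤ D.k := D.le_of_lamBond ⟨hmem, hs, ht⟩
  -- not deep at level j < k reads: centre not in Ω_{j+1}
  have hnd : ∀ {y : Site P j}, j < D.k → ¬ D.Deep j y → embIter j y ∉ Ω (j + 1) := by
    intro y hj hy hin
    apply hy
    show blockOf y ∈ D.Om (j + 1)
    rw [hOm (j + 1) (by omega) (by omega)]
    exact (hsat j hj y).mpr hin
  rcases Nat.lt_or_ge j D.k with hj | hj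
  · -- below the top
    rcases Nat.eq_zero_or_pos j with rfl | hj0
    · -- level 0: Γ₀ = Ω₁ᶜ and `embIter 0 = id`
      show embIter 0 b.src ∈ gammaRegion Ω D.k 0 ∨ embIter 0 b.tgt ∈ gammaRegion Ω D.k 0
      rw [gammaRegion_zero Ω hk1]
      exact Or.inl (hnd hj hs)
    · show embIter j b.src ∈ gammaRegion Ω D.k j ∨ embIter j b.tgt ∈ gammaRegion Ω D.k j
      rw [gammaRegion_mid Ω hj0 hj]
      rcases hmem with h | h
      · exact Or.inl ⟨(hOm j hj0 hj.le b.src).mp h, hnd hj hs⟩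
      · exact Or.inr ⟨(hOm j hj0 hj.le b.tgt).mp h, hnd hj ht⟩
  · -- at the top: Γ_k = Ω_k
    have hjeq : j = D.k := le_antisymm hjk hj
    subst hjeq
    show embIter D.k b.src ∈ gammaRegion Ω D.k D.k ∨ embIter D.k b.tgt ∈ gammaRegion Ω D.k D.k
    rw [gammaRegion_self]
    rcases hmem with h | h
    · exact Or.inl ((hOm D.k hk1 le_rfl b.src).mp h)
    · exact Or.inr ((hOm D.k hk1 le_rfl b.tgt).mp h)

end Literature.MathematicalPhysics.QuantumFieldTheory.Balaban1983to89.Node00
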